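import Summits.ValiantsHypothesis.ValiantsHypothesis.Theses.ValuativeGCT

/-!
# `ValuativeGCT.CutBites` (stmt-ValiantsHypothesis-12626), line adjugate-pfaffian-kernel
# — Stub 4 `stub_adjDet_invariant`

Invariance of the witness `W_m = det (Σ_k cof X_(k,k))` (`X_(k,k)` = row `(k,k)` of `A ∈ End(ℂ^{m×m})`
reshaped to an `m × m` matrix of coordinate functions, `cof Y = Y.adjugateᵀ`) under the crux's right action
`φ_M : X (j,i) ↦ Σ_l M l i • X (j,l)` of a matrix `M` satisfying the cofactor chain rule
`T*_M (cof (T_M Y)) = cof Y` (hypothesis `hC`) and `linSubst Mᵀ det_m = det_m` (hypothesis `hT`).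

The mathematics: `φ_M` is a `ℂ`-algebra map, so `φ_M W_m = det (Σ_k cof (T_M X_k))` (`φ_M` maps the row matrix
`X_k` to `T_M X_k`, and commutes with `det`, sums, adjugates and transposes); the chain rule transported along
`rename (fun i => ((k,k), i))` gives `cof X_k = T*_M (cof (T_M X_k))` for every `k`; `T*_M` is additive; and
`det (T*_M Z) = det Z` for a matrix `Z` over any commutative `ℂ`-algebra is `hT` pushed through the evaluation
`aeval (fun l => Z_l)`.  Chaining, `φ_M W_m = det Z = det (T*_M Z) = W_m` with `Z = Σ_k cof (T_M X_k)`.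
Used in the line to feed the witness into the highest-weight extraction (Stub 7). [folklore]
-/

namespace Summit.ValiantsHypothesis.ValiantsHypothesis.Theorems.CutBitesAdjugate

open Literature.NumberTheory.DiophantineGeometry Literature.Computability.AlgebraicComplexity
open MvPolynomial
open scoped BigOperators Matrix

-- `Summit.ValiantsHypothesis.ValiantsHypothesis.…` is the tree's mandated single-conjunct layout (Sub = Summit).
set_option linter.dupNamespace false

/-- A `ℂ`-algebra map commutes with the cofactor matrix `Y ↦ Y.adjugateᵀ`. [folklore] -/
theorem cbAdj_mapMatrix_adjugate_transpose {n : Type*} [Fintype n] [DecidableEq n]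
    {A B : Type*} [CommRing A] [CommRing B] [Algebra ℂ A] [Algebra ℂ B] (f : A →ₐ[ℂ] B)
    (Y : Matrix n n A) : f.mapMatrix Y.adjugateᵀ = (f.mapMatrix Y).adjugateᵀ := by
  rw [AlgHom.mapMatrix_apply, AlgHom.mapMatrix_apply, Matrix.transpose_map, ← AlgHom.mapMatrix_apply,
    AlgHom.map_adjugate, AlgHom.mapMatrix_apply]

/-- A `ℂ`-algebra map commutes with the `ℂ`-linear recombination
`T*_N C = of fun a b => Σ_l N (a,b) l • C_l` of the entries of a matrix. [folklore] -/
theorem cbAdj_mapMatrix_tstar {m : ℕ} {A B : Type*} [CommRing A] [CommRing B] [Algebra ℂ A] [Algebra ℂ B]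
    (f : A →ₐ[ℂ] B) (N : Matrix (MatIdx m) (MatIdx m) ℂ) (C : Matrix (Fin m) (Fin m) A) :
    f.mapMatrix (Matrix.of fun a b : Fin m => ∑ l : MatIdx m, N (toLex (a, b)) l • C (ofLex l).1 (ofLex l).2)
      = Matrix.of fun a b : Fin m => ∑ l : MatIdx m, N (toLex (a, b)) l •
          (f.mapMatrix C) (ofLex l).1 (ofLex l).2 := by
  ext a b
  simp only [AlgHom.mapMatrix_apply, Matrix.map_apply, Matrix.of_apply, map_sum, map_smul]

/-- `T*_N` is additive: it commutes with finite sums of matrices. [folklore] -/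
theorem cbAdj_tstar_sum {m : ℕ} {A : Type*} [CommRing A] [Algebra ℂ A] {ι : Type*} (s : Finset ι)
    (N : Matrix (MatIdx m) (MatIdx m) ℂ) (C : ι → Matrix (Fin m) (Fin m) A) :
    (Matrix.of fun a b : Fin m => ∑ l : MatIdx m, N (toLex (a, b)) l • (∑ k ∈ s, C k) (ofLex l).1 (ofLex l).2)
      = ∑ k ∈ s, Matrix.of fun a b : Fin m => ∑ l : MatIdx m, N (toLex (a, b)) l •
          (C k) (ofLex l).1 (ofLex l).2 := by
  ext a b
  simp only [Matrix.of_apply, Matrix.sum_apply, Finset.smul_sum]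
  exact Finset.sum_comm

/-- Evaluating `det_m` at a family `g` of elements of a commutative `ℂ`-algebra gives the determinant of the matrix
`(g (a,b))`. [folklore] -/
theorem cbAdj_aeval_detFormLex {m : ℕ} {A : Type*} [CommRing A] [Algebra ℂ A] (g : MatIdx m → A) :
    MvPolynomial.aeval (R := ℂ) g (detFormLex ℂ m) = (Matrix.of fun a b : Fin m => g (toLex (a, b))).det := by
  rw [detFormLex, detPoly, AlgHom.map_det, AlgHom.map_det]
  congr 1
  ext a b
  simp only [AlgHom.mapMatrix_apply, Matrix.map_apply, Matrix.of_apply, Matrix.mvPolynomialX, rename_X, aeval_X]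

/-- Evaluating `linSubst N det_m` at a family `g`: the determinant of `(Σ_l N l (a,b) • g l)`. [folklore] -/
theorem cbAdj_aeval_linSubst_detFormLex {m : ℕ} {A : Type*} [CommRing A] [Algebra ℂ A]
    (N : Matrix (MatIdx m) (MatIdx m) ℂ) (g : MatIdx m → A) :
    MvPolynomial.aeval (R := ℂ) g (linSubst (MatIdx m) ℂ N (detFormLex ℂ m))
      = (Matrix.of fun a b : Fin m => ∑ l : MatIdx m, N l (toLex (a, b)) • g l).det := by
  rw [detFormLex, detPoly, AlgHom.map_det, AlgHom.map_det, AlgHom.map_det]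
  congr 1
  ext a b
  simp only [AlgHom.mapMatrix_apply, Matrix.map_apply, Matrix.of_apply, Matrix.mvPolynomialX, rename_X,
    linSubst_X, map_sum, map_smul, aeval_X]

/-- `det (T*_N Z) = det Z` for every matrix `Z` over a commutative `ℂ`-algebra, as soon as
`linSubst Nᵀ det_m = det_m`: push the polynomial identity through `aeval (fun l => Z_l)`. [folklore] -/
theorem cbAdj_det_tstar_eq_det {m : ℕ} {A : Type*} [CommRing A] [Algebra ℂ A]
    (N : Matrix (MatIdx m) (MatIdx m) ℂ) (hT : linSubst (MatIdx m) ℂ Nᵀ (detFormLex ℂ m) = detFormLex ℂ m)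
    (Z : Matrix (Fin m) (Fin m) A) :
    (Matrix.of fun a b : Fin m => ∑ l : MatIdx m, N (toLex (a, b)) l • Z (ofLex l).1 (ofLex l).2).det = Z.det := by
  have h := congrArg (MvPolynomial.aeval (R := ℂ) (fun l : MatIdx m => Z (ofLex l).1 (ofLex l).2)) hT
  simp only [cbAdj_aeval_linSubst_detFormLex, cbAdj_aeval_detFormLex, Matrix.transpose_apply] at h
  exact h

/-- **Stub 4 — invariance of the witness** `W_m = det (Σ_k cof X_(k,k))` under the crux's right action of every `M`
satisfying the chain rule and `linSubst Mᵀ det_m = det_m` (so, with Stubs 1–3, under the whole abstract stabiliser).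
Why true: the action is the `ℂ`-algebra map `φ_M : X (j,i) ↦ Σ_l M l i • X (j,l)`, so
`φ_M W_m = det (Σ_k cof (T_M X_k))` (`AlgHom.map_det`, `map_sum`, `AlgHom.map_adjugate`, `Matrix.transpose_map`;
`φ_M.mapMatrix X_k = T_M X_k` by `aeval_X`); the chain rule transported along `rename (fun i => ((k,k), i))` gives
`cof X_k = T_M* (cof (T_M X_k))`; `T_M*` is additive; and `det (T_M* Z) = det Z` for matrices over any
commutative `ℂ`-algebra is `linSubst Mᵀ det_m = det_m` pushed through `aeval (fun l => Z_l)`. [folklore] -/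
theorem stub_adjDet_invariant (m : ℕ) (M : Matrix (MatIdx m) (MatIdx m) ℂ)
    (hC : (Matrix.of fun a b : Fin m => ∑ l : MatIdx m, M (toLex (a, b)) l •
        (Matrix.of fun a' b' : Fin m => ∑ l' : MatIdx m, M l' (toLex (a', b')) •
          (X l' : MvPolynomial (MatIdx m) ℂ)).adjugateᵀ (ofLex l).1 (ofLex l).2)
      = (Matrix.of fun a b : Fin m => (X (toLex (a, b)) : MvPolynomial (MatIdx m) ℂ)).adjugateᵀ)
    (hT : linSubst (MatIdx m) ℂ Mᵀ (detFormLex ℂ m) = detFormLex ℂ m) :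
    MvPolynomial.aeval
        (fun p : MatIdx m × MatIdx m => ∑ l : MatIdx m, M l p.2 • (X (p.1, l) : MvPolynomial (MatIdx m × MatIdx m) ℂ))
        (Matrix.det (∑ k : Fin m, (Matrix.of fun a b : Fin m =>
          (X (toLex (k, k), toLex (a, b)) : MvPolynomial (MatIdx m × MatIdx m) ℂ)).adjugateᵀ))
      = Matrix.det (∑ k : Fin m, (Matrix.of fun a b : Fin m =>
          (X (toLex (k, k), toLex (a, b)) : MvPolynomial (MatIdx m × MatIdx m) ℂ)).adjugateᵀ) := by
  -- the action `φ`, the transported chain rule, and the matrix `Z = Σ_k cof (T_M X_k)`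
  set φ : MvPolynomial (MatIdx m × MatIdx m) ℂ →ₐ[ℂ] MvPolynomial (MatIdx m × MatIdx m) ℂ :=
    MvPolynomial.aeval (R := ℂ) (fun p : MatIdx m × MatIdx m =>
      ∑ l : MatIdx m, M l p.2 • (X (p.1, l) : MvPolynomial (MatIdx m × MatIdx m) ℂ)) with hφ
  -- (i) `φ` maps the row matrix `X_k` to `T_M X_k`
  have hXk : ∀ k : Fin m, φ.mapMatrix (Matrix.of fun a b : Fin m =>
        (X (toLex (k, k), toLex (a, b)) : MvPolynomial (MatIdx m × MatIdx m) ℂ))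
      = Matrix.of fun a b : Fin m => ∑ l : MatIdx m, M l (toLex (a, b)) •
          (X (toLex (k, k), l) : MvPolynomial (MatIdx m × MatIdx m) ℂ) := by
    intro k
    ext a b
    simp only [hφ, AlgHom.mapMatrix_apply, Matrix.map_apply, Matrix.of_apply, aeval_X]
  -- (iii) the chain rule transported to row `(k,k)` along `rename (fun i => ((k,k), i))`
  have hCk : ∀ k : Fin m,
      (Matrix.of fun a b : Fin m => ∑ l : MatIdx m, M (toLex (a, b)) l •
        (Matrix.of fun a' b' : Fin m => ∑ l' : MatIdx m, M l' (toLex (a', b')) •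
          (X (toLex (k, k), l') : MvPolynomial (MatIdx m × MatIdx m) ℂ)).adjugateᵀ (ofLex l).1 (ofLex l).2)
      = (Matrix.of fun a b : Fin m =>
          (X (toLex (k, k), toLex (a, b)) : MvPolynomial (MatIdx m × MatIdx m) ℂ)).adjugateᵀ := by
    intro k
    have h := congrArg
      (rename (fun i : MatIdx m => (toLex (k, k), i)) :
        MvPolynomial (MatIdx m) ℂ →ₐ[ℂ] MvPolynomial (MatIdx m × MatIdx m) ℂ).mapMatrix hC
    rw [cbAdj_mapMatrix_tstar, cbAdj_mapMatrix_adjugate_transpose, cbAdj_mapMatrix_adjugate_transpose] at h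
    have hG : (rename (fun i : MatIdx m => (toLex (k, k), i)) :
          MvPolynomial (MatIdx m) ℂ →ₐ[ℂ] MvPolynomial (MatIdx m × MatIdx m) ℂ).mapMatrix
          (Matrix.of fun a b : Fin m => (X (toLex (a, b)) : MvPolynomial (MatIdx m) ℂ))
        = Matrix.of fun a b : Fin m =>
            (X (toLex (k, k), toLex (a, b)) : MvPolynomial (MatIdx m × MatIdx m) ℂ) := by
      ext a b
      simp only [AlgHom.mapMatrix_apply, Matrix.map_apply, Matrix.of_apply, rename_X]
    have hTM : (rename (fun i : MatIdx m => (toLex (k, k), i)) :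
          MvPolynomial (MatIdx m) ℂ →ₐ[ℂ] MvPolynomial (MatIdx m × MatIdx m) ℂ).mapMatrix
          (Matrix.of fun a' b' : Fin m => ∑ l' : MatIdx m, M l' (toLex (a', b')) •
            (X l' : MvPolynomial (MatIdx m) ℂ))
        = Matrix.of fun a' b' : Fin m => ∑ l' : MatIdx m, M l' (toLex (a', b')) •
            (X (toLex (k, k), l') : MvPolynomial (MatIdx m × MatIdx m) ℂ) := by
      ext a b
      simp only [AlgHom.mapMatrix_apply, Matrix.map_apply, Matrix.of_apply, map_sum, map_smul, rename_X]
    rw [hG, hTM] at h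
    exact h
  -- (ii) `φ W = det Z`
  rw [AlgHom.map_det, map_sum]
  simp only [cbAdj_mapMatrix_adjugate_transpose, hXk]
  -- (iv) `Σ_k cof X_k = T*_M Z`, (v) `det (T*_M Z) = det Z`
  conv_rhs => rw [show (∑ k : Fin m, (Matrix.of fun a b : Fin m =>
      (X (toLex (k, k), toLex (a, b)) : MvPolynomial (MatIdx m × MatIdx m) ℂ)).adjugateᵀ)
    = Matrix.of fun a b : Fin m => ∑ l : MatIdx m, M (toLex (a, b)) l •
        (∑ k : Fin m, (Matrix.of fun a' b' : Fin m => ∑ l' : MatIdx m, M l' (toLex (a', b')) •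
          (X (toLex (k, k), l') : MvPolynomial (MatIdx m × MatIdx m) ℂ)).adjugateᵀ) (ofLex l).1 (ofLex l).2
    from by rw [cbAdj_tstar_sum]; exact Finset.sum_congr rfl fun k _ => (hCk k).symm]
  rw [cbAdj_det_tstar_eq_det M hT]
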